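import Summits.BirchSwinnertonDyer.BirchSwinnertonDyer.Theorems.GenusKolyvaginAtTwoK4NegPhantomCellTopBits
import Literature.NumberTheory.EllipticCurves.ShaPrimaryModDivisibleSquare
import Literature.NumberTheory.EllipticCurves.BSDShaProofs
import Summits.BirchSwinnertonDyer.BirchSwinnertonDyer.Theorems.GenusKolyvaginAtTwoCasselsTatePairingRat
import Summits.BirchSwinnertonDyer.BirchSwinnertonDyer.Theorems.GenusKolyvaginAtTwoGenusPrimitiveSupplyAtTwoPosDiscShallowKFourPosBTwoSharpIff
import Summits.BirchSwinnertonDyer.BirchSwinnertonDyer.Theorems.GenusKolyvaginAtTwoSupplyKernelsLossless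
import Summits.BirchSwinnertonDyer.BirchSwinnertonDyer.Theorems.GenusKolyvaginAtTwoPowDvdShaCardAtTwoRTRelaxedRung
import Literature.NumberTheory.EllipticCurves.IwasawaLeadingTermProofs
import Literature.NumberTheory.EllipticCurves.ShaTorsion
import Literature.NumberTheory.EllipticCurves.StrictSelmerTorsionLevelUniformBound
import HarnessLib

/-!
# Route `GenusKolyvaginAtTwo`, crux K₄⁻ `K4Neg` (stmt-BirchSwinnertonDyer-31526) — THE PHANTOM CELL F4ᵖᵍ CLOSED MODULO THE HEEGNER DESCENT BIT

LEAD seat `bsd-line-gk2-p1` g28, `--supports stmt-BirchSwinnertonDyer-31526 --as helper`.  THEOREMS ONLY; no `sorry`.  **BSD is NOT proved here;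
K4Neg is NOT proved; nothing is closed.**  Sequel of `…KFourCellHalvingDescentPairSeparation` and `…K4NegPhantomCellTopBits`.
§1: in a cyclic `2`-group the non-zero `2`-torsion element is unique; from ONE class of `Ш(E/ℚ)` of order `≥ 2^(M₀)`, the CASSELS–TATE PAIRING
(route item 19420, PROVED: `casselsTatePairingRat_proof`) and finiteness of `Ш(E/ℚ)[2^∞]`, two classes of the same exact order `2^α ≥ 2^(M₀)` with
distinct top bits (`exists_sha_pair_distinct_topBits`).  §2 `kFourNeg_conclusion_of_bsdp_pair_of_heegnerDescent`: **the K4Neg conclusion on ANY `Δ<0`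
K₄⁻-type frame (no cut, any reduction at `2` — in particular on F4ᵖᵍ) from `BSD₂(E)` (WALL row 1's output) + `BSD₂(Wd)` (U₂'s output) + Q2 + PRINT +
ONE residual bit `hDesc`** («for every `M`, a multiple of `y_K` that is `2^M`-divisible by a point fixed by `Γ_{K(E[2^(M+2)])}` is `2^M`-divisible in
`E(K)`»; by Lawson–Wuthrich uniqueness: the Kummer class of the generator of `E(K) ⊗ ℤ₂` is not the phantom).  So on the phantom cell the K₄⁻ input of
the route is priced as WALL + U₂ + Q2 + PRINT + `hDesc`, and (NPh_K) — false there — is not needed.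
References: [McCallumLMS1991] §5; [Kolyvagin1989Izv] Thm. B₂; [LawsonWuthrich2016] §7.1; [Cassels1962ArithmeticIV]; [SilvermanAEC2009] X.4.14.
-/

set_option autoImplicit false
-- the Theorems namespace of this sub repeats the summit name by design (D-0017 nested layout)
set_option linter.dupNamespace false

noncomputable section

open scoped Classical AddSubgroup

namespace Summit.BirchSwinnertonDyer.BirchSwinnertonDyer.Theorems.GenusExact.PlusDescent

open WeierstrassCurve NumberField IsDedekindDomain Field Rat.HeightOneSpectrum Literature.NumberTheory.EllipticCurves
  Literature.NumberTheory.GaloisRepresentations Literature.NumberTheory.EllipticCurves.ModularForms AddSubgroup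
  Literature.NumberTheory.EllipticCurves.RingClassField
open Summit.BirchSwinnertonDyer.BirchSwinnertonDyer.Theses.GenusKolyvaginAtTwo
  (KolyvaginRelationAtTwo GrossZagierAllLevels MultPublishedInputsAtTwo EntireLFunctionRat MilneAnyModel)
open Summit.BirchSwinnertonDyer.BirchSwinnertonDyer.Theorems.GenusExact

/-- In an additive commutative group, if `Y` has order `2^κ` then a non-zero `2`-torsion multiple `b • Y` equals `2^(κ−1) • Y`. [folklore] -/
theorem zsmul_eq_top_of_two_torsion {G : Type*} [AddCommGroup G] (Y : G) {κ : ℕ} (hY : addOrderOf Y = 2 ^ κ) (b : ℤ)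
    (h2 : (2 : ℤ) • (b • Y) = 0) (hb : b • Y ≠ 0) : b • Y = ((2 ^ (κ - 1) : ℕ) : ℤ) • Y := by
  have hκ : κ ≠ 0 := by
    rintro rfl
    rw [pow_zero, AddMonoid.addOrderOf_eq_one_iff] at hY
    exact hb (by rw [hY, zsmul_zero])
  have hdvd : ((2 ^ κ : ℕ) : ℤ) ∣ 2 * b := by
    rw [← hY, addOrderOf_dvd_iff_zsmul_eq_zero, mul_zsmul]
    exact h2
  obtain ⟨q, hq⟩ : ((2 ^ (κ - 1) : ℕ) : ℤ) ∣ b := by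
    have h' : ((2 ^ κ : ℕ) : ℤ) = 2 * ((2 ^ (κ - 1) : ℕ) : ℤ) := by
      rw [← Nat.succ_pred_eq_of_ne_zero hκ, pow_succ]; push_cast; ring
    rw [h'] at hdvd
    exact (mul_dvd_mul_iff_left two_ne_zero).mp hdvd
  set T := ((2 ^ (κ - 1) : ℕ) : ℤ) • Y with hT
  have h2T : (2 : ℤ) • T = 0 := by
    rw [hT, smul_smul, ← addOrderOf_dvd_iff_zsmul_eq_zero, hY]
    refine ⟨1, ?_⟩
    rw [← Nat.succ_pred_eq_of_ne_zero hκ, pow_succ]; push_cast; ring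
  obtain ⟨q', r, hr, hqr⟩ : ∃ q' r : ℤ, (r = 0 ∨ r = 1) ∧ q = 2 * q' + r :=
    ⟨q / 2, q % 2, by rcases Int.emod_two_eq_zero_or_one q with h | h <;> simp [h], by omega⟩
  have hbY : b • Y = r • T := by
    rw [hq, mul_comm, mul_zsmul, ← hT, hqr, add_zsmul, mul_comm, mul_zsmul, h2T, zsmul_zero, zero_add]
  rcases hr with rfl | rfl
  · exact (hb (by rw [hbY, zero_zsmul])).elim
  · rw [hbY, one_zsmul]

/-- **Two classes of `Ш(E/ℚ)` of the same exact order `2^α ≥ 2^(M₀)` with distinct top bits** (so with `c₁ + c₂` three), from ONE class of order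
`≥ 2^(M₀)`, the Cassels–Tate pairing (`casselsTatePairingRat_proof`) and finiteness of `Ш(E/ℚ)[2^∞]`: the character `B (2^(α−1) σ) −` cannot vanish
(else a non-zero divisible element of the finite `Ш[2^∞]`); a witness `τ` has `2^α ∣ ord τ`; rescale `τ` to exact order `2^α`; pairing with `τ` separates
the top bits. [cite: SilvermanAEC2009, Thm. X.4.14] [cite: Cassels1962ArithmeticIV] -/
theorem exists_sha_pair_distinct_topBits (W : WeierstrassCurve ℚ) [W.IsElliptic]
    (hfin : Finite (AddCommGroup.primaryComponent W.sha 2)) {k M₀ : ℕ} (hM₀ : 1 ≤ M₀)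
    {a : W.galH1} (ha : a ∈ W.sha) (hka : ((2 ^ k : ℕ) : ℤ) • a = 0) (hne : ((2 ^ (M₀ - 1) : ℕ) : ℤ) • a ≠ 0) :
    ∃ (α : ℕ) (c₁ c₂ : W.galH1), M₀ ≤ α ∧ α ≤ k ∧ c₁ ∈ W.sha ∧ c₂ ∈ W.sha ∧
      ((2 ^ α : ℕ) : ℤ) • c₁ = 0 ∧ ((2 ^ α : ℕ) : ℤ) • c₂ = 0 ∧
      ((2 ^ (α - 1) : ℕ) : ℤ) • c₁ ≠ 0 ∧ ((2 ^ (α - 1) : ℕ) : ℤ) • c₂ ≠ 0 ∧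
      ((2 ^ (α - 1) : ℕ) : ℤ) • c₁ ≠ ((2 ^ (α - 1) : ℕ) : ℤ) • c₂ := by
  haveI : Fact (Nat.Prime 2) := ⟨Nat.prime_two⟩
  set σ : W.sha := ⟨a, ha⟩ with hσ
  have hσk : (2 ^ k) • σ = 0 := Subtype.ext (by
    rw [AddSubgroupClass.coe_nsmul, ZeroMemClass.coe_zero, ← natCast_zsmul]; exact hka)
  obtain ⟨α, hαk, hα⟩ : ∃ α ≤ k, addOrderOf σ = 2 ^ α :=
    (Nat.dvd_prime_pow Nat.prime_two).mp (addOrderOf_dvd_of_nsmul_eq_zero hσk)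
  have hM₀α : M₀ ≤ α := by
    by_contra hlt
    apply hne
    have h0 : (2 ^ (M₀ - 1)) • σ = 0 :=
      addOrderOf_dvd_iff_nsmul_eq_zero.mp (hα ▸ pow_dvd_pow 2 (by omega))
    have := congrArg Subtype.val h0
    rwa [AddSubgroupClass.coe_nsmul, ZeroMemClass.coe_zero, ← natCast_zsmul] at this
  have hα1 : 1 ≤ α := le_trans hM₀ hM₀α
  -- the Cassels–Tate pairing (route item 19420, PROVED)
  obtain ⟨B, halt, hker⟩ := Summit.BirchSwinnertonDyer.BirchSwinnertonDyer.Theorems.casselsTatePairingRat_proof W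
  obtain ⟨j, hj⟩ : ∃ j, α = j + 1 := ⟨α - 1, by omega⟩
  -- the character `B (2^j • σ) −` does not vanish: else `2^j • σ` is a non-zero divisible element of the finite `Ш[2^∞]`
  have hvan : ∃ τ : W.sha, B ((2 ^ j) • σ) τ ≠ 0 := by
    by_contra hno
    push Not at hno
    have hdx : (2 ^ j) • σ ∈ AddSubgroup.divisibleElements W.sha := (hker _).mp hno
    have hx2 : (2 ^ j) • σ ∈ AddCommGroup.primaryComponent W.sha 2 := by
      rw [AddCommGroup.mem_primaryComponent]
      exact ⟨1, by rw [pow_one, smul_smul, ← pow_succ', ← hj, ← hα, addOrderOf_nsmul_eq_zero]⟩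
    have hmem := mem_divisibleElements_primaryComponent_of_mem 2 hx2 hdx
    rw [divisibleElements_eq_bot_of_finite, AddSubgroup.mem_bot] at hmem
    have hlt : 2 ^ j < addOrderOf σ := by rw [hα, hj]; exact Nat.pow_lt_pow_right (by norm_num) (lt_add_one j)
    exact nsmul_ne_zero_of_lt_addOrderOf (pow_ne_zero j two_ne_zero) hlt (congrArg Subtype.val hmem)
  obtain ⟨τ, hτ⟩ := hvan
  -- `β = B σ τ` has exact order `2^α`
  set β := B σ τ with hβ
  have hβj : ¬ (2 ^ j) • β = 0 := fun h0 ↦ hτ (by rw [map_nsmul, AddMonoidHom.nsmul_apply, h0])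
  have hβα : (2 ^ (j + 1)) • β = 0 := by
    rw [hβ, ← AddMonoidHom.nsmul_apply, ← map_nsmul, ← hj, ← hα, addOrderOf_nsmul_eq_zero, map_zero, AddMonoidHom.zero_apply]
  have hordβ : addOrderOf β = 2 ^ (j + 1) := addOrderOf_eq_prime_pow hβj hβα
  -- `2^α ∣ ord τ`, `τ` of finite order: rescale `τ` to exact order `2^α`
  have hdvdτ : 2 ^ α ∣ addOrderOf τ := by
    rw [hj, ← hordβ]
    apply addOrderOf_dvd_of_nsmul_eq_zero
    rw [hβ, ← map_nsmul, addOrderOf_nsmul_eq_zero, map_zero]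
  have hfinτ : IsOfFinAddOrder τ := by
    obtain ⟨n, hn, h0⟩ := (isOfFinAddOrder_iff_nsmul_eq_zero).mp (W.isTorsion_galH1 τ.1)
    exact (isOfFinAddOrder_iff_nsmul_eq_zero).mpr ⟨n, hn, Subtype.ext (by
      rw [AddSubgroupClass.coe_nsmul, ZeroMemClass.coe_zero]; exact h0)⟩
  obtain ⟨m, hm⟩ := hdvdτ
  have hm0 : m ≠ 0 := by rintro rfl; rw [mul_zero] at hm; exact hfinτ.addOrderOf_pos.ne' hm
  set σ₁ : W.sha := σ with hσ₁def
  have hσ₁ : addOrderOf σ₁ = 2 ^ α := hα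
  set σ₂' : W.sha := m • τ with hσ₂'
  have hord₂' : addOrderOf σ₂' = 2 ^ α := by
    rw [hσ₂', addOrderOf_nsmul' τ hm0, hm, Nat.gcd_mul_left_left, Nat.mul_div_cancel _ (Nat.pos_of_ne_zero hm0)]
  -- top bits
  have hpow : 2 ^ (α - 1) < 2 ^ α := Nat.pow_lt_pow_right (by norm_num) (by omega)
  have ht₁ : (2 ^ (α - 1)) • σ₁ ≠ 0 := nsmul_ne_zero_of_lt_addOrderOf (pow_ne_zero _ two_ne_zero) (by rw [hσ₁]; exact hpow)
  have ht₂ : (2 ^ (α - 1)) • σ₂' ≠ 0 := nsmul_ne_zero_of_lt_addOrderOf (pow_ne_zero _ two_ne_zero) (by rw [hord₂']; exact hpow)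
  have hz₁ : (2 ^ α) • σ₁ = 0 := by rw [← hσ₁]; exact addOrderOf_nsmul_eq_zero σ₁
  have hz₂ : (2 ^ α) • σ₂' = 0 := by rw [← hord₂']; exact addOrderOf_nsmul_eq_zero σ₂'
  have hdist : (2 ^ (α - 1)) • σ₁ ≠ (2 ^ (α - 1)) • σ₂' := by
    intro heq
    -- pair with `τ` on the right: `B (2^j σ) τ = 2^j β ≠ 0` but `B (2^j m τ) τ = 2^j m B τ τ = 0`
    have hj' : α - 1 = j := by omega
    rw [hj'] at heq
    apply hβj
    have h := congrArg (fun x : W.sha ↦ B x τ) heq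
    simp only [hσ₂', smul_smul, map_nsmul, AddMonoidHom.nsmul_apply, halt τ, smul_zero] at h
    rw [hβ]
    exact h
  refine ⟨α, σ₁.1, σ₂'.1, hM₀α, hαk, σ₁.2, σ₂'.2, ?_, ?_, ?_, ?_, ?_⟩
  · have := congrArg Subtype.val hz₁
    rwa [AddSubgroupClass.coe_nsmul, ZeroMemClass.coe_zero, ← natCast_zsmul] at this
  · have := congrArg Subtype.val hz₂
    rwa [AddSubgroupClass.coe_nsmul, ZeroMemClass.coe_zero, ← natCast_zsmul] at this
  · intro h
    apply ht₁
    exact Subtype.ext (by rw [AddSubgroupClass.coe_nsmul, ZeroMemClass.coe_zero, ← natCast_zsmul]; exact h)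
  · intro h
    apply ht₂
    exact Subtype.ext (by rw [AddSubgroupClass.coe_nsmul, ZeroMemClass.coe_zero, ← natCast_zsmul]; exact h)
  · intro h
    apply hdist
    exact Subtype.ext (by rw [AddSubgroupClass.coe_nsmul, AddSubgroupClass.coe_nsmul, ← natCast_zsmul, ← natCast_zsmul]; exact h)

/-- **K4Neg's CONCLUSION on ANY `Δ < 0` K₄⁻-type frame — no cut, any reduction at `2`, in particular on the phantom cell F4ᵖᵍ — from `BSD₂(E)`,
`BSD₂(Wd)`, Q2, the four PRINT items and ONE residual bit `hDesc`** (frame binders of LINE 34's `offCut_of_wall_U2_of_nonPhantom` with `hNPh` DROPPED,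
WALL rows / U₂ replaced by their outputs `hBW`, `hBd`, `y_K = Ph` displayed).  Proof: pair ledger ⟹ `#Ш(E/K)[2^∞] = 4^(M₀)` ⟹ a class of order
`≥ 2^(M₀)` in `Ш(E/ℚ)` (tree); §1 ⟹ `x₁, x₂, x₁ + x₂ ∈ Sel_(2^M)(E/ℚ)` (`M = α + 1`; rank `0`: `Sel ↪ Ш[2^M]` onto) of exact order `2^α` with pairwise
distinct top bits `tᵢ` over `K`; were the top-bit pair separation spoiled for all three, the three non-zero phantoms `tᵢ + bᵢ•Y` would coincide
(Lawson–Wuthrich over `K`), putting `t₂` and `t₁ − t₂` in the `2`-torsion of `⟨Y⟩` (one non-zero element) — absurd; the `Y`-part is `hDesc`; the survivor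
feeds `exists_primitive_of_two_pow_pred_smul_ne_zero_of_pairSeparation_of_pairSupply` with the `Δ < 0` pair supply.  BSD is NOT proved; K4Neg is NOT
proved (hypotheses: BSD₂ of the pair, Q2, PRINT, `hDesc`). [cite: McCallumLMS1991, §5 Thm. 5.4] [cite: Kolyvagin1989Izv, Thm. B₂]
[cite: LawsonWuthrich2016, §7.1 and Lemma 3] [cite: SilvermanAEC2009, Thm. X.4.14] -/
theorem kFourNeg_conclusion_of_bsdp_pair_of_heegnerDescent (hQ2 : KolyvaginRelationAtTwo)
    (hGZ : GrossZagierAllLevels) (hGZK : MultPublishedInputsAtTwo) (hL : EntireLFunctionRat) (hMi : MilneAnyModel)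
    (W : WeierstrassCurve ℚ) [W.IsElliptic] [W.IsGloballyMinimal] [NeZero (W.conductorNorm ℤ)]
    (hcm : ¬ W.HasCM) (hr0 : W.analyticRank = 0) (hρ : ∀ n : ℕ, 0 < n → W.HasSurjectiveModNGaloisRep ((2 : ℤ) ^ n))
    (hT : Odd W.tamagawaProduct) (hneg : W.Δ < 0)
    (K : Type) [Field K] [NumberField K] (hIQ : IsImaginaryQuadratic K) (hodd : Odd (NumberField.discr K))
    (h3 : NumberField.discr K ≠ -3) (hHe : SatisfiesHeegnerHypothesis (W.conductorNorm ℤ) K)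
    (hsq1 : ¬ IsSquare ((NumberField.discr K : ℚ) * -|W.Δ|)) (hsq2 : ¬ IsSquare ((NumberField.discr K : ℚ) * (-(2 * |W.Δ|))))
    (Dt : ModularParametrizationData W (W.conductorNorm ℤ)) (hc : Odd Dt.c)
    (β : ℤ) (ι : K →+* ℂ) (d₁ : KolyvaginHeegnerData Dt β ι 1) (hy : ¬ IsOfFinAddOrder d₁.derivedPoint)
    (Ph : (W.baseChange K).toAffine.Point)
    (hPh : WeierstrassCurve.Affine.Point.map (W' := W) (algebraMap K (ringClassField K ι 1)).toRatAlgHom Ph = d₁.derivedPoint)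
    (M₀ : ℕ) (hdiv : ∃ Q : (W.baseChange (ringClassField K ι 1)).toAffine.Point, ((2 ^ M₀ : ℕ) : ℤ) • Q = d₁.derivedPoint)
    (hndiv : ¬ ∃ Q : (W.baseChange (ringClassField K ι 1)).toAffine.Point, ((2 ^ (M₀ + 1) : ℕ) : ℤ) • Q = d₁.derivedPoint)
    (hM₀ : 1 ≤ M₀)
    (Wd : WeierstrassCurve ℚ) [Wd.IsElliptic] [Wd.IsGloballyMinimal]
    (hWd : ∃ C : VariableChange ℚ, C • W.quadraticTwist (NumberField.discr K : ℚ) = Wd)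
    (hrd : Wd.analyticRank = 1) (hSel : Nat.card (Wd.selmerGroup 2) = 2) (hDEF : padicValNat 2 Wd.tamagawaProduct ≤ 1)
    (hBW : BSDp W 2) (hBd : BSDp Wd 2)
    (hDesc : ∀ (M : ℕ) (b : ℤ) (Q : geomPoints (W.baseChange K)),
      (∀ ρ ∈ torsionFixing (W.baseChange K) ((2 ^ (M + 2) : ℕ) : ℤ), ρ • Q = Q) →
      ((2 ^ M : ℕ) : ℤ) • Q = toGeomPoints (W.baseChange K) (b • Ph) →
      ∃ R : (W.baseChange K).toAffine.Point, ((2 ^ M : ℕ) : ℤ) • R = b • Ph) :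
    ∃ (n : ℕ) (d : KolyvaginHeegnerData Dt β ι n), Squarefree n ∧
      (∀ ℓ ∈ n.primeFactors, Zhang2014.IsKolyvaginPrime (W.conductorNorm ℤ) W K 2 ℓ ∧ 2 ≤ Zhang2014.kolyvaginIndex W 2 ℓ ∧
        FrobEqFrobInfty W K 2 ℓ) ∧
      ¬ ∃ Q : (W.baseChange (ringClassField K ι n)).toAffine.Point, (2 : ℤ) • Q = d.derivedPoint := by
  haveI : Fact (Nat.Prime 2) := ⟨Nat.prime_two⟩
  haveI hell : (W.baseChange K).IsElliptic := inferInstanceAs ((W.map (algebraMap ℚ K)).IsElliptic)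
  have hρ1 : W.HasSurjectiveModNGaloisRep ((2 : ℤ) ^ 1) := hρ 1 one_pos
  have hs2 : W.HasSurjectiveModNGaloisRep 2 := by simpa using hρ1
  have hw : W.rootNumber = 1 :=
    (Literature.Barriers.BirchSwinnertonDyer.even_analyticRank_iff_of_isNewformOf_conductorLevel Dt.isNewformOf).mp
      (by rw [hr0]; exact Even.zero)
  have hrk0 : W.mordellWeilRank = 0 := by rw [(hGZK W (by rw [hr0]; exact zero_le_one)).1, hr0]
  -- ### the sharp class from the pair ledger, and three Ш-classes with distinct top bits (Cassels–Tate)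
  have hpow := GenusSupplyNarrow.Lossless.natCard_primaryComponent_sha_baseChange_two_eq_pow_of_bsdp_pair hGZ hL hGZK hMi W hs2 hT hr0 K hIQ hodd
    h3 hHe Dt hc β ι d₁ M₀ hdiv hndiv Wd hWd hrd hBW hBd
  obtain ⟨k, a, ha, hka, hne⟩ := exists_mem_sha_two_pow_pred_smul_ne_zero_of_natCard_eq_pow W K hT hIQ hodd hHe hs2 Dt β ι d₁ hy M₀ hM₀ hndiv
    hw hrk0 Wd hWd hSel (Or.inl ⟨hneg, hDEF⟩) hpow
  obtain ⟨α, c₁, c₂, hM₀α, -, hc₁, hc₂, hz₁, hz₂, ht₁, ht₂, hdist⟩ := exists_sha_pair_distinct_topBits W hBW.2.1 hM₀ ha hka hne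
  obtain ⟨j, hj⟩ : ∃ j, α = j + 1 := ⟨α - 1, by omega⟩
  have hj' : α - 1 = j := by omega
  rw [hj'] at ht₁ ht₂ hdist
  rw [hj] at hz₁ hz₂
  -- ### the level `M = j + 2 = α + 1` and the Selmer lifts (rank `0`: `Sel_(2^M)(E/ℚ) ↪ Ш[2^M]`, onto)
  set M := j + 2 with hMdef
  have hM₀M : M₀ + 1 ≤ M := by omega
  have hn : ((2 ^ M : ℕ) : ℤ) ≠ 0 := by positivity
  have h2pow : (2 : ℤ) * ((2 ^ j : ℕ) : ℤ) = ((2 ^ (j + 1) : ℕ) : ℤ) := by push_cast; ring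
  have hdvdα : ((2 ^ (j + 1) : ℕ) : ℤ) ∣ ((2 ^ M : ℕ) : ℤ) := natCast_pow_dvd_natCast_pow (p := 2) (by omega)
  have lift : ∀ c : W.galH1, c ∈ W.sha → ((2 ^ (j + 1) : ℕ) : ℤ) • c = 0 →
      ∃ x ∈ selmerGroup W ((2 ^ M : ℕ) : ℤ), torsionH1ToH1 W ((2 ^ M : ℕ) : ℤ) x = c := by
    intro c hcs hzc
    have hMc : ((2 ^ M : ℕ) : ℤ) • c = 0 := by
      obtain ⟨e, he⟩ := hdvdα
      rw [he, mul_comm, mul_zsmul, hzc, zsmul_zero]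
    have hmem : c ∈ W.sha ⊓ AddSubgroup.torsionBy W.galH1 ((2 ^ M : ℕ) : ℤ) := AddSubgroup.mem_inf.mpr ⟨hcs, hMc⟩
    rw [← WeierstrassCurve.map_torsionH1ToH1_selmerGroup_holds W hn] at hmem
    obtain ⟨x, hx, rfl⟩ := AddSubgroup.mem_map.mp hmem
    exact ⟨x, hx, rfl⟩
  obtain ⟨x₁, hx₁, hx₁c⟩ := lift c₁ hc₁ hz₁
  obtain ⟨x₂, hx₂, hx₂c⟩ := lift c₂ hc₂ hz₂
  have hdivQ := exists_zsmul_two_pow_eq_of_rank_zero_of_odd_torsionOrder W hrk0 (odd_torsionOrder_of_hasSurjectiveModNGaloisRep_two W hs2) M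
  have hinjι : Function.Injective (torsionH1ToH1 W ((2 ^ M : ℕ) : ℤ)) := torsionH1ToH1_injective_of_divisible W hn (by convert hdivQ)
  have hzx₁ : ((2 ^ (j + 1) : ℕ) : ℤ) • x₁ = 0 := hinjι (by rw [map_zsmul, hx₁c, hz₁, map_zero])
  have hzx₂ : ((2 ^ (j + 1) : ℕ) : ℤ) • x₂ = 0 := hinjι (by rw [map_zsmul, hx₂c, hz₂, map_zero])
  have htx₁ : ((2 ^ j : ℕ) : ℤ) • x₁ ≠ 0 := fun h ↦ ht₁ (by rw [← hx₁c, ← map_zsmul, h, map_zero])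
  have htx₂ : ((2 ^ j : ℕ) : ℤ) • x₂ ≠ 0 := fun h ↦ ht₂ (by rw [← hx₂c, ← map_zsmul, h, map_zero])
  have hdistx : ((2 ^ j : ℕ) : ℤ) • x₁ ≠ ((2 ^ j : ℕ) : ℤ) • x₂ := fun h ↦
    hdist (by rw [← hx₁c, ← hx₂c, ← map_zsmul, ← map_zsmul, h])
  -- the third candidate `x₁ + x₂`
  have hx₃ : x₁ + x₂ ∈ selmerGroup W ((2 ^ M : ℕ) : ℤ) := add_mem hx₁ hx₂
  have hzx₃ : ((2 ^ (j + 1) : ℕ) : ℤ) • (x₁ + x₂) = 0 := by rw [zsmul_add, hzx₁, hzx₂, add_zero]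
  have h2tx₂ : (2 : ℤ) • (((2 ^ j : ℕ) : ℤ) • x₂) = 0 := by rw [smul_smul, h2pow, hzx₂]
  have htx₃ : ((2 ^ j : ℕ) : ℤ) • (x₁ + x₂) ≠ 0 := by
    intro h0
    rw [zsmul_add] at h0
    apply hdistx
    have h1 : ((2 ^ j : ℕ) : ℤ) • x₁ = -(((2 ^ j : ℕ) : ℤ) • x₂) := eq_neg_of_add_eq_zero_left h0
    rw [h1, neg_eq_iff_add_eq_zero, ← two_zsmul, h2tx₂]
  -- `2^(M₀−1) • x ≠ 0` for each candidate
  have sharp : ∀ x : galH1Torsion W ((2 ^ M : ℕ) : ℤ), ((2 ^ j : ℕ) : ℤ) • x ≠ 0 → ((2 ^ (M₀ - 1) : ℕ) : ℤ) • x ≠ 0 := by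
    intro x hx h0
    apply hx
    have hsplit : ((2 ^ j : ℕ) : ℤ) = ((2 ^ (j - (M₀ - 1)) : ℕ) : ℤ) * ((2 ^ (M₀ - 1) : ℕ) : ℤ) := by
      push_cast; rw [← pow_add]; congr 1; omega
    rw [hsplit, mul_zsmul, h0, zsmul_zero]
  -- ### the `K`-side: restriction and change of level are injective; `Y = ι c_M(1)`
  have h2 : Module.finrank ℚ K = 2 := hIQ.1
  obtain ⟨θ, hθ, hd⟩ := Literature.NumberTheory.QuadraticFields.Quadratic.exists_not_mem_range_sq_eq_discr (K := K) h2
  have htorsK : ∀ (m : ℕ) (P : (W.baseChange K).toAffine.Point), ((2 ^ m : ℕ) : ℤ) • P = 0 → P = 0 := fun m P hP ↦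
    EigenClassesFinite.forall_zsmul_two_pow_baseChange_eq_zero_of_hasSurjectiveModNGaloisRep_two W K h2 hs2 m P
      (by exact_mod_cast hP)
  have hbotK : AddSubgroup.torsionBy (W.baseChange K).toAffine.Point ((2 : ℕ) : ℤ) = ⊥ := by
    rw [eq_bot_iff]; intro P hP; rw [AddSubgroup.mem_bot]; exact htorsK 1 P (by simpa using hP)
  have hinjres : Function.Injective (resTorsion W K ((2 ^ M : ℕ) : ℤ)) :=
    EigenClassesFinite.resTorsion_injective_of_noTorsion W K h2 hθ hd ((2 ^ M : ℕ) : ℤ) (htorsK M)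
  have hdvd2 : ((2 ^ M : ℕ) : ℤ) ∣ ((2 ^ (M + 2) : ℕ) : ℤ) := natCast_pow_dvd_natCast_pow (p := 2) (by omega)
  set ι₂ := torsionH1OfDvd (W.baseChange K) hdvd2 with hι₂
  have hι₂inj : Function.Injective ι₂ := VisiblePairAtTwo.torsionH1OfDvd_pow_injective (W.baseChange K) (p := 2) hbotK hdvd2
  set S : galH1Torsion W ((2 ^ M : ℕ) : ℤ) → galH1Torsion (W.baseChange K) ((2 ^ (M + 2) : ℕ) : ℤ) :=
    fun x ↦ ι₂ (resTorsion W K ((2 ^ M : ℕ) : ℤ) x) with hSdef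
  have hSinj : Function.Injective S := hι₂inj.comp hinjres
  have hSsmul : ∀ (c : ℤ) (x : galH1Torsion W ((2 ^ M : ℕ) : ℤ)), S (c • x) = c • S x := fun c x ↦ by
    simp only [hSdef, map_zsmul]
  have hSadd : ∀ x x' : galH1Torsion W ((2 ^ M : ℕ) : ℤ), S (x + x') = S x + S x' := fun x x' ↦ by simp only [hSdef, map_add]
  have hS0 : S 0 = 0 := by simp only [hSdef, map_zero]
  set Y := ι₂ (d₁.kolyvaginClass Nat.prime_two M) with hYdef
  obtain ⟨κ, -, hκ⟩ : ∃ κ ≤ M + 2, addOrderOf Y = 2 ^ κ :=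
    (Nat.dvd_prime_pow Nat.prime_two).mp (addOrderOf_dvd_of_nsmul_eq_zero (nsmul_galH1Torsion_natCast_eq_zero _ (2 ^ (M + 2)) Y))
  -- the phantom predicate, the Heegner top bit (`hDesc`) and the pairwise Lawson–Wuthrich lemma
  set Φ : galH1Torsion (W.baseChange K) ((2 ^ (M + 2) : ℕ) : ℤ) → Prop := fun z ↦
    ∀ ρ' ∈ torsionFixing (W.baseChange K) ((2 ^ (M + 2) : ℕ) : ℤ), h1Eval (W.baseChange K) ((2 ^ (M + 2) : ℕ) : ℤ) z ρ' = 0 with hΦdef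
  have hYpart : ∀ b : ℤ, Φ (b • Y) → b • Y = 0 := fun b hb ↦
    zsmul_kolyvaginClass_one_eq_zero_of_phantom_of_descent W K hIQ hodd hHe hρ1 Dt β ι d₁ Ph hPh M hdvd2 (hDesc M) b hb
  have hLW : ∀ {z₁ z₂ : galH1Torsion (W.baseChange K) ((2 ^ (M + 2) : ℕ) : ℤ)}, Φ z₁ → Φ z₂ → z₁ = 0 ∨ z₂ = 0 ∨ z₁ = z₂ :=
    fun h₁ h₂ ↦ GenusKolyTwoAdicK.eq_zero_or_eq_zero_or_eq_of_forall_h1Eval_eq_zero_heegner W hIQ hodd hsq1 hsq2 hρ (M + 1) h₁ h₂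
  -- top bits `t x = 2^j • S x`: `2`-torsion; a non-zero `2`-torsion multiple of `S x` IS `t x` when `x` has exact order `2^(j+1)`
  have h2t : ∀ x : galH1Torsion W ((2 ^ M : ℕ) : ℤ), ((2 ^ (j + 1) : ℕ) : ℤ) • x = 0 → (2 : ℤ) • (((2 ^ j : ℕ) : ℤ) • S x) = 0 := by
    intro x hzx
    rw [smul_smul, h2pow, ← hSsmul, hzx, hS0]
  have hSord : ∀ x : galH1Torsion W ((2 ^ M : ℕ) : ℤ), ((2 ^ (j + 1) : ℕ) : ℤ) • x = 0 → ((2 ^ j : ℕ) : ℤ) • x ≠ 0 →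
      addOrderOf (S x) = 2 ^ (j + 1) := by
    intro x hzx htx
    refine addOrderOf_eq_prime_pow ?_ ?_
    · intro h0
      apply htx
      apply hSinj
      rw [hSsmul, hS0]
      rw [← natCast_zsmul] at h0
      exact h0
    · rw [← natCast_zsmul]
      have := congrArg S hzx
      rw [hSsmul, hS0] at this
      exact this
  have htop : ∀ (x : galH1Torsion W ((2 ^ M : ℕ) : ℤ)) (c : ℤ), ((2 ^ (j + 1) : ℕ) : ℤ) • x = 0 → ((2 ^ j : ℕ) : ℤ) • x ≠ 0 →
      (2 : ℤ) • (c • S x) = 0 → c • S x ≠ 0 → c • S x = ((2 ^ j : ℕ) : ℤ) • S x := by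
    intro x c hzx htx h2c hc0
    have h := zsmul_eq_top_of_two_torsion (S x) (hSord x hzx htx) c h2c hc0
    rwa [Nat.add_sub_cancel] at h
  -- the pair separation holds for a candidate unless a witness `b` spoils it
  have key : ∀ (x : galH1Torsion W ((2 ^ M : ℕ) : ℤ)), ((2 ^ (j + 1) : ℕ) : ℤ) • x = 0 → ((2 ^ j : ℕ) : ℤ) • x ≠ 0 →
      (¬ ∃ b : ℤ, (2 : ℤ) • (b • Y) = 0 ∧ Φ (((2 ^ j : ℕ) : ℤ) • S x + b • Y) ∧ ((2 ^ j : ℕ) : ℤ) • S x + b • Y ≠ 0) →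
      ∀ (hd' : ((2 ^ M : ℕ) : ℤ) ∣ ((2 ^ (M + 2) : ℕ) : ℤ)) (a b : ℤ),
        (2 : ℤ) • (a • torsionH1OfDvd (W.baseChange K) hd' (resTorsion W K ((2 ^ M : ℕ) : ℤ) x)) = 0 →
        (2 : ℤ) • (b • torsionH1OfDvd (W.baseChange K) hd' (d₁.kolyvaginClass Nat.prime_two M)) = 0 →
        (∀ ρ' ∈ torsionFixing (W.baseChange K) ((2 ^ (M + 2) : ℕ) : ℤ),
          h1Eval (W.baseChange K) ((2 ^ (M + 2) : ℕ) : ℤ)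
            (a • torsionH1OfDvd (W.baseChange K) hd' (resTorsion W K ((2 ^ M : ℕ) : ℤ) x) +
              b • torsionH1OfDvd (W.baseChange K) hd' (d₁.kolyvaginClass Nat.prime_two M)) ρ' = 0) →
        a • torsionH1OfDvd (W.baseChange K) hd' (resTorsion W K ((2 ^ M : ℕ) : ℤ) x) +
          b • torsionH1OfDvd (W.baseChange K) hd' (d₁.kolyvaginClass Nat.prime_two M) = 0 := by
    intro x hzx htx hno hd' a b h2a h2b hab
    change (2 : ℤ) • (a • S x) = 0 at h2a
    change (2 : ℤ) • (b • Y) = 0 at h2b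
    change Φ (a • S x + b • Y) at hab
    change a • S x + b • Y = 0
    by_cases ha0 : a • S x = 0
    · rw [ha0, zero_add] at hab ⊢
      exact hYpart b hab
    · have haS : a • S x = ((2 ^ j : ℕ) : ℤ) • S x := htop x a hzx htx h2a ha0
      rw [haS] at hab ⊢
      by_contra hne0
      exact hno ⟨b, h2b, hab, hne0⟩
  -- ### the counting: not all three candidates are spoiled
  have main : ∃ x : galH1Torsion W ((2 ^ M : ℕ) : ℤ), x ∈ selmerGroup W ((2 ^ M : ℕ) : ℤ) ∧ ((2 ^ (j + 1) : ℕ) : ℤ) • x = 0 ∧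
      ((2 ^ j : ℕ) : ℤ) • x ≠ 0 ∧
      ¬ ∃ b : ℤ, (2 : ℤ) • (b • Y) = 0 ∧ Φ (((2 ^ j : ℕ) : ℤ) • S x + b • Y) ∧ ((2 ^ j : ℕ) : ℤ) • S x + b • Y ≠ 0 := by
    by_contra hno
    push Not at hno
    obtain ⟨b₁, h2b₁, hΦ₁, hne₁⟩ := hno x₁ hx₁ hzx₁ htx₁
    obtain ⟨b₂, h2b₂, hΦ₂, hne₂⟩ := hno x₂ hx₂ hzx₂ htx₂
    obtain ⟨b₃, h2b₃, hΦ₃, hne₃⟩ := hno (x₁ + x₂) hx₃ hzx₃ htx₃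
    set t₁ := ((2 ^ j : ℕ) : ℤ) • S x₁ with ht₁def
    set t₂ := ((2 ^ j : ℕ) : ℤ) • S x₂ with ht₂def
    have ht₃ : ((2 ^ j : ℕ) : ℤ) • S (x₁ + x₂) = t₁ + t₂ := by rw [hSadd, zsmul_add]
    rw [ht₃] at hΦ₃ hne₃
    have htne₁ : t₁ ≠ 0 := fun h ↦ htx₁ (hSinj (by rw [hSsmul, hS0]; exact h))
    have htne₂ : t₂ ≠ 0 := fun h ↦ htx₂ (hSinj (by rw [hSsmul, hS0]; exact h))
    have htdist : t₁ ≠ t₂ := fun h ↦ hdistx (hSinj (by rw [hSsmul, hSsmul]; exact h))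
    have h2t₁ : (2 : ℤ) • t₁ = 0 := h2t x₁ hzx₁
    have h2t₂ : (2 : ℤ) • t₂ = 0 := h2t x₂ hzx₂
    -- the three non-zero phantoms coincide
    have h12 : t₁ + b₁ • Y = t₂ + b₂ • Y := by
      rcases hLW hΦ₁ hΦ₂ with h | h | h; exacts [(hne₁ h).elim, (hne₂ h).elim, h]
    have h13 : t₁ + b₁ • Y = t₁ + t₂ + b₃ • Y := by
      rcases hLW hΦ₁ hΦ₃ with h | h | h; exacts [(hne₁ h).elim, (hne₃ h).elim, h]
    -- `t₂ = (b₁ − b₃) • Y` is the top bit `T` of `Y`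
    have ht₂Y : t₂ = (b₁ - b₃) • Y := by
      have h' : b₁ • Y = t₂ + b₃ • Y := add_left_cancel (h13.trans (add_assoc _ _ _))
      rw [sub_zsmul, ← sub_eq_add_neg, h', add_sub_cancel_right]
    have hT₂ : (b₁ - b₃) • Y = ((2 ^ (κ - 1) : ℕ) : ℤ) • Y :=
      zsmul_eq_top_of_two_torsion Y hκ (b₁ - b₃) (by rw [← ht₂Y]; exact h2t₂) (by rw [← ht₂Y]; exact htne₂)
    -- `t₁ − t₂ = (b₂ − b₁) • Y` is `0` or `T`; both are absurd
    have h12' : t₁ - t₂ = (b₂ - b₁) • Y := by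
      rw [sub_zsmul, ← sub_eq_add_neg]
      exact sub_eq_sub_iff_add_eq_add.mpr (h12.trans (add_comm _ _))
    by_cases h0 : (b₂ - b₁) • Y = 0
    · rw [h0, sub_eq_zero] at h12'
      exact htdist h12'
    · have hT₁₂ : (b₂ - b₁) • Y = ((2 ^ (κ - 1) : ℕ) : ℤ) • Y :=
        zsmul_eq_top_of_two_torsion Y hκ (b₂ - b₁) (by rw [← h12', zsmul_sub, h2t₁, h2t₂, sub_zero]) h0
      apply htne₁
      have : t₁ = t₂ + t₂ := by
        rw [← sub_eq_iff_eq_add, h12', hT₁₂, ← hT₂, ← ht₂Y]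
      rw [this, ← two_zsmul, h2t₂]
  -- ### the surviving candidate feeds the halving descent without (NPh_K)
  obtain ⟨x, hx, hzx, htx, hgood⟩ := main
  have hSep := key x hzx htx hgood
  obtain ⟨ℓ, d, hkol, hidx, hΦℓ, -, -, -, hwit⟩ :=
    exists_primitive_of_two_pow_pred_smul_ne_zero_of_pairSeparation_of_pairSupply (fun ℓ ↦ FrobEqFrobInfty W K 2 ℓ) hQ2 W hcm hT K hIQ hodd
      h3 hHe hρ hsq1 hsq2 Dt β ι d₁ M₀ hndiv hw (pairSupply_frobEqFrobInfty_of_Δ_neg W hcm hneg K hIQ hsq1 hρ) M hM₀M x hx (sharp x htx) hSep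
  have hℓp : ℓ.Prime := hkol.1
  refine ⟨1 * ℓ, d, by rw [one_mul]; exact hℓp.squarefree, fun q hq ↦ ?_, hwit⟩
  rw [one_mul, hℓp.primeFactors, Finset.mem_singleton] at hq
  subst hq
  exact ⟨hkol, le_trans (by omega) hidx, hΦℓ⟩

end Summit.BirchSwinnertonDyer.BirchSwinnertonDyer.Theorems.GenusExact.PlusDescent

end
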